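import Summits.BirchSwinnertonDyer.Rank1Residual.X11b.CastellaErratumGrossZagier
import Summits.BirchSwinnertonDyer.Rank1Residual.X11b.ChaRoute
import Literature.NumberTheory.EllipticCurves.ManinConstantSemistablePrimewise
import HarnessLib

/-!
# X11b, route R1 — the end form per pair and datum, and the OPTIMAL case with no Manin package

HONEST FRAMING (cell `b2b-bsdres`, verbatim): the goal of the cell is to DELETE the
COMBINATION-SHAPED residual classes for ALL analytic-rank `≤ 1` curves over `ℚ` — "full BSD
formula for every rank `≤ 1` curve in class C" assembled STRICTLY from published theorems — so that
the rank-`≤ 1` remainder becomes exactly the CONSTRUCTION-SHAPED classes, which are TYPED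
(missing-input `Prop`s), NOT attempted. This is not "finishing BSD". Sub-cell `b2b-bsdres-multr1-p1`,
research route R1 for X11b (Castella 2018 Thm. A re-proved along the author's erratum). THEOREMS
ONLY; CONDITIONAL on the listed inputs, exactly one of which is unrefereed (the display (A));
deletes nothing; X11b stays CONSTRUCTION-SHAPED.

* `bsdp_of_display_datum` — the end form of route R1 PER PAIR AND DATUM: for `W/ℚ` globally minimal
  elliptic on `ChainLocus` at `p` with `ord_{s=1} L(E,s) = 1` and a parametrisation datum `Dt` at
  level `N_E` with `p ∤ c(Dt)`: `BSD(E,p)` from the eight PUBLISHED named facts of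
  `routeGoal_of_display` and the single OPEN input (A) (display (5.3) at data with `p ∤ c`).
  (`routeGoal_of_display` = this + the package `hMan` supplying such a datum.)
* `bsdp_of_display_of_optimalDatum` — **the `X₀(N)`-OPTIMAL case with NO package**: if `W` carries
  an optimal datum `D` (`Λ_E ⊆ c·Λ_f`, i.e. `φ_D` is the optimal parametrisation and `c = c(D)` its
  Manin constant), then `p ∤ c` is Mazur 1978 Cor. 4.1 (PUBLISHED named fact
  `mazur_not_dvd_maninConstant_of_odd`: `p` odd, `p² ∤ N` — here `p ∥ N` as `p` is multiplicative,
  `not_sq_dvd_conductorNorm_of_mult`), so `BSD(E,p)` follows from NINE published named facts and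
  (A) alone. This is literally Castella's setting ("`E` an elliptic curve of conductor `N`" with
  its optimal parametrisation), for every conductor.
-/

noncomputable section

open scoped Classical

open WeierstrassCurve NumberField Literature.NumberTheory.EllipticCurves
  Literature.NumberTheory.EllipticCurves.ModularForms
  Literature.NumberTheory.EllipticCurves.Rank1Residual
  Literature.NumberTheory.EllipticCurves.Rank1Residual.Typed

namespace Summit.BirchSwinnertonDyer.Rank1Residual.X11b

/-- **Route R1 per pair and datum: `BSD(E,p)` on `ChainLocus` from published named facts, a datum
with `p ∤ c(Dt)`, and the ONE open input (A).** Inputs as in `routeGoal_of_display` (`hGZ`, `hGZK`,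
`hSk`, `hmod`, `hEx`, `hRat`, `hCST`, `hFH` PUBLISHED; `hA` OPEN at data with `p ∤ c`); the datum
`Dt` at level `N_E` with `p ∤ c(Dt)` is an explicit argument. Proof: the field of §5
(`erratumField_supply`), the non-torsion Heegner point of `Dt` (`heegnerDatumSupply_of_caiShuTian`),
a globally minimal model of the twist with its transports (`twistTransportAt_of_twist`), the links
(B) (`gzParaphraseAt_of_datum`) and (C) (`tamagawaDescentAt_of_isErratumField`), and `bsdp_of_links`.
CONDITIONAL on `hA`; deletes nothing. [cite: Castella2018, §5 (arXiv:1704.06608 p. 12)]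
[cite: Castella2018Erratum, Thm. 1.1 and Thm. A′ (p. 1)] -/
theorem bsdp_of_display_datum
    (hGZ : GrossZagier1986_thm_I_7_3) (hGZK : rank_eq_analyticRank_of_analyticRank_le_one)
    (hSk : Skinner2016.thmC_padicValRat_bsd_rank_zero) (hmod : exists_isNewformOf)
    (hEx : CaiShuTian2014.exists_isHeegnerPoint_of_heegnerCondition)
    (hRat : CaiShuTian2014.exists_map_eq_heegnerPointComplex_of_heegnerCondition)
    (hCST : CaiShuTian2014.thm11_trivialChar)
    (hFH : friedbergHoffstein_exists_twist_ne_zero_ramifiedAt)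
    (hA : ∀ (W : WeierstrassCurve ℚ) [W.IsElliptic] [W.IsGloballyMinimal] [NeZero (W.conductorNorm ℤ)]
        (p : ℕ) [Fact p.Prime] (q : ℕ) [Fact q.Prime] (K : Type) [Field K] [NumberField K]
        (Dt : ModularParametrizationData W (W.conductorNorm ℤ))
        (H : HeegnerDatum (W.conductorNorm ℤ) (NumberField.discr K)) (ι : K →+* ℂ)
        (P : (W.baseChange K).toAffine.Point),
        ErratumHypotheses W p → W.analyticRank = 1 → q ≠ p → Mult W q →
        ¬ W.HasSplitMultiplicativeReductionAtPrime q → ¬ p ∣ padicValInt q W.minimalDiscriminantInt →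
        IsErratumField W K q →
        WeierstrassCurve.Affine.Point.map ι.toRatAlgHom P = heegnerPointComplex Dt H →
        ¬ (p : ℤ) ∣ Dt.c → ¬ IsOfFinAddOrder P → Display53At W p K P)
    (W : WeierstrassCurve ℚ) [W.IsElliptic] [W.IsGloballyMinimal] [NeZero (W.conductorNorm ℤ)]
    (p : ℕ) [Fact p.Prime] (hCL : ChainLocus W p) (hr : W.analyticRank = 1)
    (Dt : ModularParametrizationData W (W.conductorNorm ℤ)) (hc : ¬ (p : ℤ) ∣ Dt.c) :
    BSDp W p := by
  have hE : ErratumHypotheses W p := hCL.erratumHypotheses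
  obtain ⟨⟨q, hqF, ℓ, hℓF, hqp, hℓp, hℓq, hmq, hnsq, hvq, hmℓ, hvℓ⟩, -⟩ := hCL.2.2.2
  have hmodE : hasEntireLFunction_rat := hasEntireLFunction_rat_of_exists_isNewformOf hmod
  obtain ⟨K, _, _, hKf⟩ := erratumField_supply hmod hFH W p q hr hmq hnsq
  obtain ⟨H, ι, P, hP, hnt⟩ :=
    heegnerDatumSupply_of_caiShuTian W hmodE hEx hRat hCST hr hmq hnsq hKf Dt
  have hd0 : (NumberField.discr K : ℚ) ≠ 0 := by exact_mod_cast NumberField.discr_ne_zero K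
  haveI := W.isElliptic_quadraticTwist hd0
  obtain ⟨C, hCmin⟩ := hasGlobalMinimalModel_rat_holds (W.quadraticTwist (NumberField.discr K : ℚ))
  set Wd := C • W.quadraticTwist (NumberField.discr K : ℚ) with hWd_def
  haveI : Wd.IsGloballyMinimal := hCmin
  have hWd : ∃ C' : VariableChange ℚ, C' • W.quadraticTwist (NumberField.discr K : ℚ) = Wd :=
    ⟨C, rfl⟩
  obtain ⟨htm, hti, htr⟩ := twistTransportAt_of_twist W p hKf.1 Wd hWd
  have hsp : SplitsIn K p := hKf.splitsIn_of_mult hE.2.1 (Ne.symm hqp)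
  have hsℓ : SplitsIn K ℓ := hKf.splitsIn_of_mult hmℓ hℓq
  have hmultd : Mult Wd p := htm hsp hE.2.1
  have hirrd : Irr Wd p := hti hE.2.2.1
  obtain ⟨hmℓd, hvℓd⟩ := htr ℓ hℓp hsℓ hmℓ hvℓ
  have hLd : Wd.entireLFunction 1 ≠ 0 := by
    rw [hWd_def, WeierstrassCurve.entireLFunction_smul]
    exact hKf.2.2.2.2
  exact bsdp_of_links W p hGZ hGZK hSk hE.1 hE.2.2.1 hr K hKf.1 Wd hWd hLd hmultd hirrd
    ⟨ℓ, hℓF, hℓp, hmℓd, hvℓd⟩ P (hA W p q K Dt H ι P hE hr hqp hmq hnsq hvq hKf hP hc hnt)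
    (gzParaphraseAt_of_datum W p hE.1 hGZK hmodE hCST hr hE.2.2.1 hmq hnsq hKf hsp Dt H ι P hP hc
      hnt Wd (Cd := C) rfl)
    (tamagawaDescentAt_of_isErratumField W p hE.1 q hmq hvq K hKf Wd hWd)

/-- **The OPTIMAL case of route R1 with NO Manin package: `BSD(E,p)` from NINE published named
facts and the ONE open input (A).** For `W/ℚ` globally minimal elliptic on `ChainLocus` at `p` with
`ord_{s=1} L(E,s) = 1`, carrying an OPTIMAL parametrisation datum `D` (`Λ_E ⊆ c·Λ_f`: `φ_D` is the
`X₀(N)`-optimal parametrisation, `c = c(D)` its Manin constant; Edixhoven 1991 Prop. 2): Mazur 1978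
Cor. 4.1 (`mazur_not_dvd_maninConstant_of_odd`, PUBLISHED; `p` odd and `p² ∤ N_E` because `p` is
multiplicative, `not_sq_dvd_conductorNorm_of_mult`) gives `p ∤ c(D)`, and `bsdp_of_display_datum`
applies. CONDITIONAL on `hA`; deletes nothing. [cite: Mazur1978, Cor. 4.1]
[cite: Castella2018Erratum, Thm. 1.1 and Thm. A′ (p. 1)] -/
theorem bsdp_of_display_of_optimalDatum
    (hGZ : GrossZagier1986_thm_I_7_3) (hGZK : rank_eq_analyticRank_of_analyticRank_le_one)
    (hSk : Skinner2016.thmC_padicValRat_bsd_rank_zero) (hmod : exists_isNewformOf)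
    (hEx : CaiShuTian2014.exists_isHeegnerPoint_of_heegnerCondition)
    (hRat : CaiShuTian2014.exists_map_eq_heegnerPointComplex_of_heegnerCondition)
    (hCST : CaiShuTian2014.thm11_trivialChar)
    (hFH : friedbergHoffstein_exists_twist_ne_zero_ramifiedAt)
    (hMaz : mazur_not_dvd_maninConstant_of_odd)
    (hA : ∀ (W : WeierstrassCurve ℚ) [W.IsElliptic] [W.IsGloballyMinimal] [NeZero (W.conductorNorm ℤ)]
        (p : ℕ) [Fact p.Prime] (q : ℕ) [Fact q.Prime] (K : Type) [Field K] [NumberField K]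
        (Dt : ModularParametrizationData W (W.conductorNorm ℤ))
        (H : HeegnerDatum (W.conductorNorm ℤ) (NumberField.discr K)) (ι : K →+* ℂ)
        (P : (W.baseChange K).toAffine.Point),
        ErratumHypotheses W p → W.analyticRank = 1 → q ≠ p → Mult W q →
        ¬ W.HasSplitMultiplicativeReductionAtPrime q → ¬ p ∣ padicValInt q W.minimalDiscriminantInt →
        IsErratumField W K q →
        WeierstrassCurve.Affine.Point.map ι.toRatAlgHom P = heegnerPointComplex Dt H →
        ¬ (p : ℤ) ∣ Dt.c → ¬ IsOfFinAddOrder P → Display53At W p K P)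
    (W : WeierstrassCurve ℚ) [W.IsElliptic] [W.IsGloballyMinimal] [NeZero (W.conductorNorm ℤ)]
    (p : ℕ) [Fact p.Prime] (hCL : ChainLocus W p) (hr : W.analyticRank = 1)
    (D : ModularParametrizationData W (W.conductorNorm ℤ))
    (hopt : ∀ z ∈ D.L.lattice, ∃ w ∈ periodLattice D.f, z = D.c * w) : BSDp W p := by
  have hE : ErratumHypotheses W p := hCL.erratumHypotheses
  have hp : p.Prime := Fact.out
  have hc : ¬ (p : ℤ) ∣ D.c :=
    hMaz W D hopt p hp (by have := hE.1; omega) (not_sq_dvd_conductorNorm_of_mult (W := W) (p := p) hE.2.1)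
  exact bsdp_of_display_datum hGZ hGZK hSk hmod hEx hRat hCST hFH hA W p hCL hr D hc

end Summit.BirchSwinnertonDyer.Rank1Residual.X11b

end
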